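import Literature.IUT.LogVolume.Corollary22TorsionCoordinates
import Literature.IUT.LogVolume.Corollary22FullGaloisImage
import Literature.IUT.LogVolume.Corollary22QParamBaseChange
import Literature.NumberTheory.EllipticCurves.DivisionFieldRamificationProofs
import Literature.NumberTheory.GaloisRepresentations.InertiaFixesPrimeToResidueRootsProofs
import Literature.NumberTheory.DiophantineGeometry.GenEllMellReduction
import Literature.NumberTheory.DiophantineGeometry.LocalReductionFiniteBadPlacesProofs
import Literature.NumberTheory.NumberFields.UnramifiedDescentPrimeDegree
import Literature.NumberTheory.NumberFields.RamificationIdxAlgEquiv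
import HarnessLib

/-!
# [IUTchIV] Thm. 1.10, Step (ii) / (D0): ramification in the GENUINE theta tower
# `F_tpd ⊆ F = F_tpd(√−1, E[3·5]) ⊆ K = F(E_F[l])` of a point of the `λ`-line — the instance forms of
# Prop. 1.8 (vi), (vii) that the printed proof consumes

Mochizuki, *Inter-universal Teichmüller theory IV*, RIMS manuscript (Apr. 2020; = PRIMS **57** (2021)),
proof of Thm. 1.10, Step (ii) p. 24 ("the extension `F/F_tpd` is tamely ramified over such primes — cf.
Proposition 1.8, (vi), (vii)"; "since the extension `K/F` is tamely ramified at the primes that do not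
divide `l`, and we have a natural outer inclusion `Gal(K/F) ↪ GL_2(𝔽_l)`") and Step (iii) p. 26, (D0):
"if `v ∈ 𝕍(F_tpd)^non` does not divide `2·3·5·l` and, moreover, is not contained in `Supp(𝔮^{F_tpd}_ADiv)`,
then the extension `K/F_tpd` is unramified over `v`" — "it follows immediately from Proposition 1.8, (vi),
(vii), together with our assumption on `𝕍(F)^good ∩ 𝕍(F)^non`".

Here the point `x_E = λ` is presented over `F_tpd = P.F` (`P : NFPoint`, `λ ∈ U_X`), `F ⊇ F_tpd` is any
theta field of `P` (`Cor22.IsThetaField P F`: `F = F_tpd(√−1, E_{F_tpd}[3·5])`, Galois over `F_tpd` of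
degree dividing `46080 = 2^{10}·3^2·5`, `E_F` semistable), `E_F` is the Legendre curve of `λ` over `F`
(`Cor22.thetaCurve`), and `K ⊇ F` is any number field Galois over `F` lying inside the `l`-division
field `F(E_F[l])` — witnessed by an `F`-embedding `ψ : K → F̄` whose image is fixed by `ker ρ̄_{E_F,l}`
(for `K = F(E_F[l])` itself this is [IUTchI] Def. 3.1 (c), `InitialThetaData.range_K_iff`). PROVED
(theorems only; classical — Néron–Ogg–Shafarevich easy half and Tate-curve tameness via abc-iut-S5's
`DivisionFieldRamificationProofs` / `InertiaFixesPrimeToResidueRootsProofs`, Galois degree bookkeeping):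

* `one_lt_valuation_j_thetaCurve_iff` — `|j(E_F)|_w > 1` iff the place of `F_tpd` under `w` is a bad place
  of `λ` (a pole of `j(λ)`); `thetaCurve_hasGoodReductionAt_of_not_mem_badPlaces` /
  `thetaCurve_hasMultiplicativeReductionAt_of_mem_badPlaces` — `E_F` (semistable) has GOOD reduction at
  the places of `F` over the good places of `λ` and MULTIPLICATIVE reduction over the bad ones (the
  assumption "`E_F` has good reduction at every valuation `∈ 𝕍(F)^good ∩ 𝕍(F)^non`…", automatic for the
  (P5) choice of `𝕍^bad_mod`);
* `ramificationIdx_divisionTower_eq_one` — **`K/F` is unramified at the good places `w ∤ l`**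
  (Prop. 1.8 (vii), first sentence); `exists_ramificationIdx_divisionTower_eq_pow` /
  `not_dvd_ramificationIdx_divisionTower` — **at every place `w ∤ l` of `F`, `e(u|w)` is a power of `l`**,
  so `K/F` is tamely ramified away from `l` (Prop. 1.8 (vii), second sentence, (v));
  `finrank_divisionTower_dvd` — `[K:F] ∣ l(l−1)²(l+1) = |GL₂(𝔽_l)|` ("`Gal(K/F) ↪ GL_2(𝔽_l)`");
* `ramificationIdx_thetaField_dvd` / `not_dvd_ramificationIdx_thetaField` — `e(w|v) ∣ 46080`, so
  `F/F_tpd` is tamely ramified at every place of residue characteristic `∉ {2,3,5}` ("`Gal(F/F_tpd) ↪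
  GL_2(𝔽_3) × GL_2(𝔽_5) × ℤ/2ℤ`"; Prop. 1.8 (vi), (vii));
The UNRAMIFIED half — `F/F_tpd` unramified at the good places `v ∤ 2·3·5` (the Legendre equation has good
reduction there; inertia fixes `√−1` and the `15`-torsion coordinates) and (D0) for `K/F_tpd` — is the sequel
`ThetaTowerUnramified.lean`; the different/conductor bookkeeping of Step (ii) is `Theorem110GenuineStepII.lean`.
Deliberately NOT here: any log-volume content; anything about [IUTchIII] Cor. 3.12 (no side is
taken; these are classical facts about torsion fields of the Legendre curve, kernel-checked by us).
-/

noncomputable section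

open scoped Classical

namespace Literature.IUT.LogVolume

namespace Cor22

open NumberField IsDedekindDomain Literature.NumberTheory.DiophantineGeometry.GenEll
open Literature.NumberTheory.EllipticCurves Literature.NumberTheory.GaloisRepresentations
open Literature.NumberTheory.NumberFields WeierstrassCurve IntermediateField Field

universe v

variable {P : NFPoint} (F : Type) [Field F] [NumberField F] [Algebra P.F F]

/-! ## The reduction type of `E_F` at a place of `F` is read on the place of `F_tpd` below it -/

/-- `w` is a pole of `j(E_F) = j(λ)` iff the place `v = w ∩ 𝓞_{F_tpd}` is a bad place of `λ`
(`ord_w = e(w|v)·ord_v`). [cite: Mochizuki2012, IUTchIV Thm 1.10 p.22] -/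
theorem one_lt_valuation_j_thetaCurve_iff (hU : P.InU) (w : HeightOneSpectrum (𝓞 F)) :
    letI := thetaCurve_isElliptic hU F
    1 < w.valuation F (thetaCurve P F).j ↔ finBelow P.F F w ∈ badPlaces P := by
  letI := thetaCurve_isElliptic hU F
  letI : Algebra P.F (extend P F).F := ‹Algebra P.F F›
  refine Iff.trans ?_ (mem_badPlaces_iff_of_algebraMap (P := P) (Q := extend P F) rfl w)
  rw [thetaCurve_j F hU, jInv_map]
  unfold badPlaces
  rw [Set.Finite.mem_toFinset]
  rfl

/-- **`E_F` has good reduction over the good places of `λ`**: for a theta field `F` (`E_F` semistable,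
Prop. 1.8 (v)) and a place `w` of `F` over a place of `F_tpd` at which `j(λ)` is integral, `E_F` has good
reduction at `w` (a semistable curve with `|j|_w ≤ 1` is not multiplicative at `w`; Silverman VII.5.1).
This is Thm. 1.10's standing assumption "`E_F` has good reduction at every valuation `∈ 𝕍(F)^good ∩
𝕍(F)^non` that does not divide `2l`" for the (P5) choice of `𝕍^bad_mod` (indeed at ALL good places of `λ`).
[cite: Mochizuki2012, IUTchIV Thm 1.10 p.22] [cite: SilvermanAEC2009, Prop. VII.5.1] -/
theorem thetaCurve_hasGoodReductionAt_of_not_mem_badPlaces (hU : P.InU) (hF : IsThetaField P F)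
    (w : HeightOneSpectrum (𝓞 F)) (hw : finBelow P.F F w ∉ badPlaces P) :
    (thetaCurve P F).HasGoodReductionAt w := by
  haveI := thetaCurve_isElliptic hU F
  rcases hF.isSemistable w with hgood | hmult
  · exact hgood
  · exfalso
    exact hw ((one_lt_valuation_j_thetaCurve_iff F hU w).1
      (one_lt_valuation_j_of_hasMultiplicativeReduction_localMinimalModel w (thetaCurve P F) hmult))

/-- **`E_F` has multiplicative reduction over the bad places of `λ`** (semistable, and `|j|_w > 1` excludes
good reduction, Silverman VII.5.1 (a)). [cite: Mochizuki2012, IUTchIV Cor 2.2 (ii) proof (P5) p.46]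
[cite: SilvermanAEC2009, Prop. VII.5.1] -/
theorem thetaCurve_hasMultiplicativeReductionAt_of_mem_badPlaces (hU : P.InU) (hF : IsThetaField P F)
    (w : HeightOneSpectrum (𝓞 F)) (hw : finBelow P.F F w ∈ badPlaces P) :
    (thetaCurve P F).HasMultiplicativeReductionAt w := by
  haveI := thetaCurve_isElliptic hU F
  rcases hF.isSemistable w with hgood | hmult
  · exfalso
    have h1 := valuation_j_le_one_of_hasGoodReduction_localMinimalModel w (thetaCurve P F) hgood
    exact absurd ((one_lt_valuation_j_thetaCurve_iff F hU w).2 hw) (not_lt.2 h1)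
  · exact hmult

/-! ## The layer `K/F`: `K ⊆ F(E_F[l])` Galois over `F`, presented by an `F`-embedding into `F̄` -/

section DivisionTower

variable {K : Type} [Field K] [NumberField K] [Algebra F K] (ψ : K →ₐ[F] AlgebraicClosure F)

variable {F}

/-- **`K/F` is unramified at the good places not dividing `l`** (Prop. 1.8 (vii), first sentence:
"If `E_k` has good reduction over `O_k`, then the action of `G_k` on `E_k[n]` is unramified"; here for
`K ⊆ F(E_F[l])` Galois over `F` and a place `u` of `K` over a place `w ∤ l` of `F` lying over a good
place of `λ`: `e(u|w) = 1`). [cite: Mochizuki2012, IUTchIV Prop 1.8 (vii) p.19]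
[cite: SilvermanAEC2009, Prop. VII.4.1(a)] -/
theorem ramificationIdx_divisionTower_eq_one (hU : P.InU) (hF : IsThetaField P F) [IsGalois F K] {l : ℕ}
    (hK : letI := thetaCurve_isElliptic hU F
      ((thetaCurve P F).galoisRepTorsion (l : ℤ)).ker ≤ ψ.fieldRange.fixingSubgroup)
    (u : HeightOneSpectrum (𝓞 K)) (hlu : ((l : ℕ) : 𝓞 F) ∉ (finBelow F K u).asIdeal)
    (hgood : finBelow P.F F (finBelow F K u) ∉ badPlaces P) :
    u.asIdeal.ramificationIdx (𝓞 F) = 1 := by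
  letI := thetaCurve_isElliptic hU F
  haveI : FiniteDimensional F K := Module.Finite.of_restrictScalars_finite ℚ F K
  let e : K ≃ₐ[F] ψ.fieldRange :=
    ((IntermediateField.topEquiv (F := F) (E := K)).symm.trans (IntermediateField.equivMap ⊤ ψ)).trans
      (IntermediateField.equivOfEq (AlgHom.fieldRange_eq_map ψ).symm)
  haveI : FiniteDimensional F ψ.fieldRange := LinearEquiv.finiteDimensional e.toLinearEquiv
  haveI : IsGalois F ψ.fieldRange := IsGalois.of_algEquiv e
  haveI : NumberField ψ.fieldRange := NumberField.of_module_finite F ψ.fieldRange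
  set Q : Ideal (𝓞 ψ.fieldRange) :=
    u.asIdeal.map (RingOfIntegers.mapAlgEquiv e : 𝓞 K ≃ₐ[𝓞 F] 𝓞 ψ.fieldRange) with hQ
  haveI : Q.IsPrime := isPrime_map_mapAlgEquiv e u
  haveI : Q.LiesOver (finBelow F K u).asIdeal := liesOver_map_mapAlgEquiv e u _
  rw [← ramificationIdx_map_mapAlgEquiv e u]
  exact (thetaCurve P F).ramificationIdx_divisionField_eq_one_of_hasGoodReductionAt ψ.fieldRange hK
    (thetaCurve_hasGoodReductionAt_of_not_mem_badPlaces F hU hF _ hgood) (by exact_mod_cast hlu) Q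

/-- **`K/F` is tamely ramified at every place not dividing `l`: `e(u|w)` is a power of `l`** for `l`
prime (Prop. 1.8 (vii): at a good place `w ∤ l`, `e(u|w) = 1 = l^0`; at a multiplicative place `w ∤ l` the
`l`-division field is tamely ramified with index dividing `l` — in the tree's form, a power of `l`).
[cite: Mochizuki2012, IUTchIV Prop 1.8 (vii) p.19] [cite: SilvermanATAEC1994, V.4–V.5, Ex. 5.13 (b)] -/
theorem exists_ramificationIdx_divisionTower_eq_pow (hU : P.InU) (hF : IsThetaField P F) [IsGalois F K]
    {l : ℕ}
    (hl : l.Prime)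
    (hK : letI := thetaCurve_isElliptic hU F
      ((thetaCurve P F).galoisRepTorsion (l : ℤ)).ker ≤ ψ.fieldRange.fixingSubgroup)
    (u : HeightOneSpectrum (𝓞 K)) (hlu : ((l : ℕ) : 𝓞 F) ∉ (finBelow F K u).asIdeal) :
    ∃ k : ℕ, u.asIdeal.ramificationIdx (𝓞 F) = l ^ k := by
  letI := thetaCurve_isElliptic hU F
  by_cases hgood : finBelow P.F F (finBelow F K u) ∉ badPlaces P
  · exact ⟨0, by rw [pow_zero]; exact ramificationIdx_divisionTower_eq_one ψ hU hF hK u hlu hgood⟩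
  rw [not_not] at hgood
  haveI : FiniteDimensional F K := Module.Finite.of_restrictScalars_finite ℚ F K
  let e : K ≃ₐ[F] ψ.fieldRange :=
    ((IntermediateField.topEquiv (F := F) (E := K)).symm.trans (IntermediateField.equivMap ⊤ ψ)).trans
      (IntermediateField.equivOfEq (AlgHom.fieldRange_eq_map ψ).symm)
  haveI : FiniteDimensional F ψ.fieldRange := LinearEquiv.finiteDimensional e.toLinearEquiv
  haveI : IsGalois F ψ.fieldRange := IsGalois.of_algEquiv e
  haveI : NumberField ψ.fieldRange := NumberField.of_module_finite F ψ.fieldRange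
  set Q : Ideal (𝓞 ψ.fieldRange) :=
    u.asIdeal.map (RingOfIntegers.mapAlgEquiv e : 𝓞 K ≃ₐ[𝓞 F] 𝓞 ψ.fieldRange) with hQ
  haveI : Q.IsPrime := isPrime_map_mapAlgEquiv e u
  haveI : Q.LiesOver (finBelow F K u).asIdeal := liesOver_map_mapAlgEquiv e u _
  rw [← ramificationIdx_map_mapAlgEquiv e u]
  exact (thetaCurve P F).exists_ramificationIdx_divisionField_eq_pow_of_hasMultiplicativeReductionAt hl
    ψ.fieldRange hK (thetaCurve_hasMultiplicativeReductionAt_of_mem_badPlaces F hU hF _ hgood)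
    (by exact_mod_cast hlu) Q

/-- **No prime `p ≠ l` divides `e(u|w)` at a place `w ∤ l`** — the tameness of `K/F` away from `l` in the
form Prop. 1.3 (i) consumes ("the extension `K/F` is tamely ramified at the primes that do not divide `l`",
Step (ii) p. 24). [cite: Mochizuki2012, IUTchIV Thm 1.10 proof Step (ii) p.24] -/
theorem not_dvd_ramificationIdx_divisionTower (hU : P.InU) (hF : IsThetaField P F) [IsGalois F K] {l : ℕ}
    (hl : l.Prime)
    (hK : letI := thetaCurve_isElliptic hU F
      ((thetaCurve P F).galoisRepTorsion (l : ℤ)).ker ≤ ψ.fieldRange.fixingSubgroup)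
    (u : HeightOneSpectrum (𝓞 K)) (hlu : ((l : ℕ) : 𝓞 F) ∉ (finBelow F K u).asIdeal)
    {p : ℕ} (hp : p.Prime) (hpl : p ≠ l) :
    ¬ p ∣ u.asIdeal.ramificationIdx (𝓞 F) := by
  obtain ⟨k, hk⟩ := exists_ramificationIdx_divisionTower_eq_pow ψ hU hF hl hK u hlu
  rw [hk]
  intro h
  exact hpl ((Nat.prime_dvd_prime_iff_eq hp hl).mp (hp.dvd_of_dvd_pow h))

omit [NumberField K] in
/-- **"`Gal(K/F) ↪ GL_2(𝔽_l)`"**: `[K:F]` divides `l·(l−1)²·(l+1) = |GL₂(𝔽_l)|` ((E3); Serre 1972 §4.1).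
[cite: Mochizuki2012, IUTchIV Thm 1.10 proof Step (ii) p.24] [cite: Serre1972, §4.1] -/
theorem finrank_divisionTower_dvd (hU : P.InU) {l : ℕ} [Fact l.Prime]
    (hK : letI := thetaCurve_isElliptic hU F
      ((thetaCurve P F).galoisRepTorsion (l : ℤ)).ker ≤ ψ.fieldRange.fixingSubgroup) :
    Module.finrank F K ∣ l * (l - 1) ^ 2 * (l + 1) := by
  letI := thetaCurve_isElliptic hU F
  let e : K ≃ₐ[F] ψ.fieldRange :=
    ((IntermediateField.topEquiv (F := F) (E := K)).symm.trans (IntermediateField.equivMap ⊤ ψ)).trans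
      (IntermediateField.equivOfEq (AlgHom.fieldRange_eq_map ψ).symm)
  rw [e.toLinearEquiv.finrank_eq]
  exact (thetaCurve P F).finrank_dvd_of_ker_galoisRepTorsion_le_fixingSubgroup l ψ.fieldRange hK

end DivisionTower

/-! ## The layer `F/F_tpd`: degree and tameness -/

/-- **"`Gal(F/F_tpd) ↪ GL_2(𝔽_3) × GL_2(𝔽_5) × ℤ/2ℤ`"**: `e(w|v) ∣ [F:F_tpd] ∣ 46080 = 2^{10}·3^2·5`
for every place `w` of the theta field `F` (`F/F_tpd` Galois). [cite: Mochizuki2012, IUTchIV Thm 1.10 proof Step (ii) p.24] -/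
theorem ramificationIdx_thetaField_dvd (hF : IsThetaField P F) (w : HeightOneSpectrum (𝓞 F)) :
    w.asIdeal.ramificationIdx (𝓞 P.F) ∣ 46080 := by
  haveI := hF.isGalois
  haveI := w.isPrime
  haveI : (finBelow P.F F w).asIdeal.IsMaximal := (finBelow P.F F w).isMaximal
  exact (ramificationIdx_dvd_finrank_of_isGalois (finBelow P.F F w).asIdeal w.asIdeal).trans hF.finrank_dvd

/-- **`F/F_tpd` is tamely ramified at every place of residue characteristic `p ∉ {2,3,5}`**: such `p` does
not divide `e(w|v) ∣ 2^{10}·3^2·5` ("the extension `F/F_tpd` is tamely ramified over such primes — cf.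
Proposition 1.8, (vi), (vii)", Step (ii) p. 24). [cite: Mochizuki2012, IUTchIV Thm 1.10 proof Step (ii) p.24] -/
theorem not_dvd_ramificationIdx_thetaField (hF : IsThetaField P F) (w : HeightOneSpectrum (𝓞 F))
    {p : ℕ} (hp : p.Prime) (h2 : p ≠ 2) (h3 : p ≠ 3) (h5 : p ≠ 5) :
    ¬ p ∣ w.asIdeal.ramificationIdx (𝓞 P.F) := by
  intro h
  have h' := h.trans (ramificationIdx_thetaField_dvd F hF w)
  have h46080 : (46080 : ℕ) = 2 ^ 10 * 3 ^ 2 * 5 := by norm_num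
  rw [h46080] at h'
  rcases (Nat.Prime.dvd_mul hp).1 h' with h23 | h5'
  · rcases (Nat.Prime.dvd_mul hp).1 h23 with h2' | h3'
    · exact h2 ((Nat.prime_dvd_prime_iff_eq hp Nat.prime_two).1 (hp.dvd_of_dvd_pow h2'))
    · exact h3 ((Nat.prime_dvd_prime_iff_eq hp Nat.prime_three).1 (hp.dvd_of_dvd_pow h3'))
  · exact h5 ((Nat.prime_dvd_prime_iff_eq hp (by norm_num)).1 h5')

end Cor22

end Literature.IUT.LogVolume

end
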